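import Literature.NumberTheory.Automorphic.HarrisLanTaylorThorneCor627
import HarnessLib

/-!
# Varma 2024, the `2n`-dimensional family `R_{p,ı}(π, N)` (Thm. 5.1 + Prop. 7.1 ⇒ Cor. 8.12, with HLTT Cor. 6.27) — the named fact

Topic `Literature/NumberTheory/Automorphic`. ONE named fact (D-0014), no proofs:
`Varma2024.prop71_twoN`, VERBATIM the hypothesis binder `h57` of the accepted
`Literature.NumberTheory.Automorphic.Varma2024.theorem1_unramified_traces_of_prop71`
(`VarmaTheorem1BaseChangeProofs.lean` ll. 528–563, p115556; the same binder heads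
`theorem92_traces_of_prop71`, `VarmaTheorem92TracesProofs.lean`:202) — librarian sweep g24,
vend-from-binder, promote event 3366983 (the provefact seat may not mint it, `lint.fact-fanout`).
First consumers: those two theorems, whence `theorem1_unramified_traces_holds :=
theorem1_unramified_traces_of_prop71 prop71_twoN_holds ‹Arthur–Clozel arch›_holds ‹AC cuspidal›_holds`.

## Source and reading (locators checked against the published text, review-split 2026-08-16)

I. Varma, *Local–global compatibility for regular algebraic cuspidal automorphic representations when
`ℓ ≠ p`*, Forum Math. Sigma 12 (2024) e21 (the arXiv text 1411.2520v1 is numbered differently and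
much terser; all locators below are those of the published version).

* Standing hypotheses (p. 4, "Notation and conventions"): "`F⁺` totally real, `F₀` imaginary
  quadratic, `F = F₀F⁺` … `p` a rational prime that splits in `F₀` … `n` a positive integer, and if
  `F⁺ = ℚ`, assume `n > 2`."  In the fact: `IsCMField K`, the subfield `F₀` with
  `finrank ℚ F₀ = 2 ∧ IsTotallyComplex F₀`, `HasTwoPrimesOver F₀ p`, and the binder
  `Module.finrank ℚ K = 2 → 2 < n` (`F⁺ = ℚ` iff `K = F₀` iff `[K : ℚ] = 2`).
* Thm. 5.1 (p. 16): for `n > 1`, `ρ` irreducible algebraic on `L_{(n),lin}`, `π` cuspidal on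
  `L_{(n),lin}(𝔸) = GL_n(𝔸_F)` with `π_∞` of the infinitesimal character of `ρ^∨` [= `π` regular
  algebraic], and `M ≫ 0`, every irreducible subquotient `π_j` of
  `Ind_{P⁺_{(n)}(𝔸^{p,∞})}^{G(𝔸^{p,∞})}(π^∞‖det‖^M × ψ^∞)` is a subquotient of an admissible
  `Π′ ⊆ H†_{≤ a} ⊆ H⁰(𝔛^{ord,min}, 𝓔^{sub}_{ρ(M)})_{ℚ̄_p}` (occurrence in ordinary overconvergent
  `p`-adic cusp forms on the unitary similitude group `G`; proof: HLTT Cor. 1.9, Lemma 6.12,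
  Cor. 6.17, Lemma 6.20, Cor. 6.25).
* Prop. 7.1 (p. 20): for such `Π` "there is a continuous semisimple representation
  `R_p(Π) : G_F → GL_{2n}(ℚ̄_p)` with the following property: If `ℓ ≠ p` is a rational prime such
  that either `ℓ` splits in `F₀`, or both `F` and `Π` are unramified above `ℓ`, and `v | ℓ` is a prime
  of `F`, then `WD(R_p(Π)|_{G_{F_v}})^{ss} ≃ rec_{F_v}((Π_ℓ)_v |det|_v^{(1−2n)/2})^{ss}`."
* Cor. 8.12 and its proof (p. 30) and the proof of Thm. 9.2 (p. 31): `Π` is chosen with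
  `Π_v = π_v|det|^M ⊞ π^{c,∨}_{v^c}|det|^{−M}` at the `v | ℓ ∈ S_spl` (`ℓ ≠ p` split in `F₀`), and
  `R_p(π, M) := R_p(ı⁻¹Π) ⊗ ε_p^{−M}`; with `μ := ε_p^{−2}`, `𝔉` = the elements `σ_v ∈ W_{F_v}`
  projecting to a power of Frobenius, `𝓔¹_{σ_v}` = the roots of the characteristic polynomial of
  `ı⁻¹rec_{F_v}(π_v|det|_v^{(1−n)/2})(σ_v)` and `𝓔²_{σ_v}` = those of
  `ı⁻¹rec_{F_{ᶜv}}(π_{ᶜv}|det|^{(−1+3n)/2}_{ᶜv})(σ_{ᶜv}^{−1})`, the multiset of roots of the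
  characteristic polynomial of `ρ_m(σ_v) = R_p(π, m)(σ_v)` is `𝓔¹_{σ_v} ⊔ 𝓔²_{σ_v} μ(σ_v)^m` — the
  input of Prop. 9.1 (= HLTT Prop. 7.12) yielding (9.1).  Clause (c) of the fact is this identity at
  the places `v ∤ p` over `q` split in `F₀` where `π_v` is unramified with Satake parameter `α`: for
  `σ ∈ φ^d I_𝔓` (`φ` an arithmetic Frobenius, `d ≠ 0`) `𝓔¹_σ` = the `d`-th powers of the roots of
  `arithFrobPolyOfSatake ı q_v n α` and `μ(σ)^m = ε_p(σ)^{−2m} = q_v^{−2dm}` (`ε_p(φ) = q_v`); the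
  `n` non-zero numbers `𝓔²_σ` are left existential (`E₂ v 𝔓 φ d σ`, card `n`, `0 ∉`).
* Clauses (a)–(b) (semisimplicity; unramified with the displayed Frobenius characteristic
  polynomial at the `v ∤ p` over `q` split in `F₀` or unramified in `K` above which `π` is
  unramified) are Harris–Lan–Taylor–Thorne, Cor. 6.27 (p. 225) for the same family — verbatim the
  conclusion of `HarrisLanTaylorThorne2016.corollary627_splitOrUnramified` (see that file's module
  docstring for the rendering); HLTT's `R_{p,ı}(π, N)` and Varma's `R_p(π, N)` are semisimple with
  the same Frobenius characteristic polynomials at almost all places (both decompose as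
  `r_{p,ı}(π) ⊕ r_{p,ı}(ᶜπ)^{c,∨} ⊗ ε_p^{1−2n−2N}`: Varma (9.2), p. 31; HLTT proof of Thm. 7.13,
  p. 232), hence are isomorphic (Chebotarev + Brauer–Nesbitt), so one family carries (a)–(c).

Rendered over the tree's vocabulary exactly as consumed by the in-tree proofs of (9.1) / Thm. 9.2 /
Cor. 9.3 (`isCompact_glFiniteIntegralLevel`, `CuspidalAutomorphicRepData`, `FramedGaloisRep`,
`HasFrobCharpolyAt`, `arithFrobPolyOfSatake`, `HasTwoPrimesOver`, `IsArithFrobAt`, …, all from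
`HarrisLanTaylorThorneCor627.lean` and its imports).

## Status: apex named fact (cited, not expected to be discharged in the tree)

The proof of this statement is the Shimura-variety theory of HLTT §§1–6 (toroidal/minimal
compactifications of the `U(n,n)` Shimura variety, rigid cohomology of the ordinary locus, `p`-adic
interpolation) together with Varma §§4–8 (Galois representations of the classical cusp forms on `G`
with full local–global compatibility, Prop. 4.2 = HLTT Cor. 5.12 via Shin, Mœglin–Waldspurger,
Chenevier–Harris, Caraiani; Bernstein-centre Hecke algebras at the split places, §6; interpolation
of pseudorepresentations, Lemma 7.2 and the proof of Prop. 7.1, §7).  None of it exists in Mathlib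
or `Literature/`; there is no in-tree prerequisite whose discharge would yield `prop71_twoN_holds`
(in particular it does NOT follow from `corollary627_splitOrUnramified`, whose family is quantified
existentially and which lacks (c)).  What is deliberately NOT here: the construction of
`R_{p,ı}(π, N)`.
-/

noncomputable section

open scoped MatrixGroups Matrix Classical Polynomial NumberField IntermediateField Pointwise
open NumberField IsDedekindDomain Field Polynomial Filter

namespace Literature.NumberTheory.Automorphic

namespace Varma2024

open Literature.NumberTheory.GaloisRepresentations
open Literature.NumberTheory.Automorphic.HarrisLanTaylorThorne2016
open Literature.NumberTheory.GaloisRepresentations.IsNonarchimedeanLocalField (residueFieldCard)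

/-- **Varma 2024, the family `R_{p,ı}(π, N)` of Cor. 8.12 (from Thm. 5.1 + Prop. 7.1), with HLTT
Cor. 6.27 — the root-multiset input of Prop. 9.1 / (9.1).** For `n > 1`, a CM field `K` with an
imaginary quadratic subfield `F₀` in which `p` splits, and `n > 2` if `K` itself is quadratic (Varma's
standing hypotheses, p. 4: `F = F₀F⁺`, `p` split in `F₀`, "if `F⁺ = ℚ`, assume `n > 2`"), a
compact-level datum `hcpt`, a regular algebraic cuspidal `π` on `GL_n(𝔸_K)` and `ı : ℚ̄_p ≃ ℂ`, there
are `N₀`, a family `R : ℕ → FramedGaloisRep K ℚ̄_p (2n)` (the printed `R_p(π, N) = R_p(ı⁻¹Π) ⊗ ε_p^{−N}`,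
`Π` from Thm. 5.1, `R_p(Π)` from Prop. 7.1; Cor. 8.12, p. 30), multisets `B v` (card `n`, no zero)
and error multisets `E₂ v 𝔓 φ d σ` (card `n`, no zero) such that for `N ≥ N₀`: (a) `R N` is
semisimple; (b) at every `v ∤ p` over a rational `q` split in `F₀` or unramified in `K`, with `π`
unramified above `q` and Satake parameter `α` at `v`, `R N` is unramified at `v` with Frobenius
characteristic polynomial `arithFrobPolyOfSatake ı q_v n α · ∏_{b ∈ B v}(X − b·q_v^{−2N})` (HLTT
Cor. 6.27, verbatim the conclusion of `corollary627_splitOrUnramified`); (c) at every `v` over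
`q ≠ p` split in `F₀` with `π_v` unramified of Satake parameter `α`, for `𝔓 ∣ v`, an arithmetic
Frobenius `φ` at `𝔓`, `d ≠ 0` and `σ ∈ φ^d · I_𝔓`, the roots of `charpoly (R N) σ` are the `d`-th
powers of the roots of `arithFrobPolyOfSatake ı q_v n α` plus `E₂ v 𝔓 φ d σ` scaled by `q_v^{−2dN}`
— the identity "roots of `charpoly ρ_m(σ_v)` `= 𝓔¹_{σ_v} ⊔ 𝓔²_{σ_v} μ(σ_v)^m`, `μ = ε_p^{−2}`" of the
proof of Thm. 9.2 (p. 31), which the paper obtains from Prop. 7.1 (p. 20: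
`WD(R_p(Π)|_{G_{F_v}})^{ss} ≃ rec_{F_v}((Π_ℓ)_v|det|_v^{(1−2n)/2})^{ss}` for `ℓ ≠ p` split in `F₀`)
and the choice `Π_v = π_v|det|^N ⊞ π^{c,∨}_{v^c}|det|^{−N}` (p. 30), with `ε_p(φ) = q_v`.  VERBATIM the
binder `h57` of `theorem1_unramified_traces_of_prop71` and of `theorem92_traces_of_prop71`; users
take `(h57 : prop71_twoN)`.  Apex named fact (D-0014): its proof is the Shimura-variety theory of
HLTT §§1–6 and Varma §§4–8, none of which is in the tree (module docstring, "Status").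
[cite: VarmaFMS2024, p. 4 (standing hypotheses); Thm. 5.1 (p. 16); Prop. 7.1 (p. 20); Cor. 8.12 and its proof (p. 30); proof of Thm. 9.2 up to (9.1) (p. 31)]
[cite: HarrisLanTaylorThorneRMS2016, Cor. 6.27 (p. 225)] -/
def prop71_twoN : Prop :=
  ∀ {n : ℕ} {K : Type} [Field K] [NumberField K]
    (hcpt : isCompact_glFiniteIntegralLevel n K) (p : ℕ) [Fact p.Prime], 1 < n → IsCMField K →
    ∀ (F₀ : IntermediateField ℚ K), Module.finrank ℚ F₀ = 2 ∧ IsTotallyComplex F₀ →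
    HasTwoPrimesOver F₀ p → (Module.finrank ℚ K = 2 → 2 < n) →
    ∀ (π : CuspidalAutomorphicRepData n K hcpt), π.1.IsRegularAlgebraic →
    ∀ (ι : PadicAlgCl p ≃+* ℂ),
    ∃ (N₀ : ℕ) (R : ℕ → FramedGaloisRep K (PadicAlgCl p) (2 * n))
      (B : HeightOneSpectrum (𝓞 K) → Multiset (PadicAlgCl p))
      (E₂ : HeightOneSpectrum (𝓞 K) → Ideal (absIntegers (𝓞 K) K) → absoluteGaloisGroup K →
        ℤ → absoluteGaloisGroup K → Multiset (PadicAlgCl p)),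
      (∀ N, N₀ ≤ N → (R N).toGaloisRep.IsSemisimple) ∧
      (∀ v, Multiset.card (B v) = n ∧ (0 : PadicAlgCl p) ∉ B v) ∧
      (∀ v 𝔓 φ d σ, Multiset.card (E₂ v 𝔓 φ d σ) = n ∧ (0 : PadicAlgCl p) ∉ E₂ v 𝔓 φ d σ) ∧
      (∀ q : ℕ, q.Prime → q ≠ p →
        (HasTwoPrimesOver F₀ q ∨ Algebra.IsUnramifiedIn (𝓞 K) (Ideal.span {(q : ℤ)})) →
        π.1.IsUnramifiedAbove q →
        ∀ v : HeightOneSpectrum (𝓞 K), ((q : ℕ) : 𝓞 K) ∈ v.asIdeal →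
        ∀ α : Multiset ℂ, π.1.HasSatakeParamAt v α → ∀ N, N₀ ≤ N →
          (R N).IsUnramifiedAt v ∧
          (R N).HasFrobCharpolyAt v (arithFrobPolyOfSatake ι v.residueCard n α *
            ((B v).map fun b ↦ X - C (b * ((v.residueCard : PadicAlgCl p)⁻¹) ^ (2 * N))).prod)) ∧
      (∀ q : ℕ, q.Prime → q ≠ p → HasTwoPrimesOver F₀ q →
        ∀ v : HeightOneSpectrum (𝓞 K), ((q : ℕ) : 𝓞 K) ∈ v.asIdeal →
        ∀ α : Multiset ℂ, π.1.HasSatakeParamAt v α →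
        ∀ 𝔓 ∈ v.primesAbove, ∀ φ : absoluteGaloisGroup K, IsArithFrobAt (𝓞 K) φ 𝔓 →
        ∀ d : ℤ, d ≠ 0 → ∀ σ : absoluteGaloisGroup K,
          σ * (φ ^ d)⁻¹ ∈ 𝔓.inertia (absoluteGaloisGroup K) → ∀ N, N₀ ≤ N →
          (FramedRep.charpoly (R N) σ).roots =
            (arithFrobPolyOfSatake ι v.residueCard n α).roots.map (· ^ d) +
              (E₂ v 𝔓 φ d σ).map
                (· * (v.residueCard : PadicAlgCl p) ^ (-(2 * d * (N : ℤ)))))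

end Varma2024

end Literature.NumberTheory.Automorphic

end
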